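import Summits.FinalStateConjecture.FinalStateConjecture.Theorems.EIHFluxBalanceInertialRecessionLorentz
import Literature.Geometry.Lorentzian.KerrConvergenceProofs

/-!
# Route EIHFluxBalance — `InertialRecession`, line `sublinear-is-free-clean-window-charges`:
# SHARP spatial decay of the (boosted) Kerr–Schild perturbation (helpers for `stub_chargeModel`)

Helper file (`--supports stmt-FinalStateConjecture-10166`) for the crux
`Summit.FinalStateConjecture.FinalStateConjecture.Theses.EIHFluxBalance.InertialRecession`.

The window law of the line bounds the flux through a `δ`-clear coordinate sphere of radius `R` by
`C ∫ R² b²` with `b` a bound on the FIRST derivatives of the lab metric on the sphere; to get the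
integrable rate `R² b² ≤ C R^{-3/2}` one needs `b ≤ K R^{-7/4}`, and for the background part this
requires the sharp `O(M/d²)` decay of the first SPATIAL derivatives of the Kerr–Schild perturbation
(the tree's `Kerr.norm_iteratedFDeriv_ksPert_le` and the modulated bounds of
`…InertialRecessionAnsatzDecay` record only `O(1/d)`). This file proves:

* `norm_iteratedFDeriv_ksPert_le_sharp` — `‖Dᵐ(g_{M,a} − η)(x)‖ ≤ C / ‖x~‖^{m+1}` for `r(x) ≥ R₀`
  (the same scaling proof, keeping the factor `ε^{m+1}`);
* `norm_fderiv_kerr_bilin_le` — the case `m = 1`: `‖D g_{M,a}(x)‖ ≤ C / ‖x~‖²`;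
* `norm_fderiv_boostedKerrBilin_le` — for the FROZEN boosted, translated field
  `y ↦ g_{M,a}(Λ⁻¹(y − p))(Λ⁻¹·, Λ⁻¹·)`: differentiable with
  `‖D(boostedKerrBilin Λ p M a)(y)‖ ≤ C ‖Λ⁻¹‖³ / ‖(Λ⁻¹(y − p))~‖²` once `r(Λ⁻¹(y − p)) ≥ R₀`;
* `fderiv_apply_eq_of_eqOn_slice` — two functions on `E4` that agree on the slice `{z⁰ = y⁰}` and are
  differentiable at `y` have the same derivative at `y` in every spatial direction `w` (`w⁰ = 0`):
  this is how the spatial derivatives of the MODULATED background (frames `Λᵢ(y⁰)`, centres `ξᵢ(y⁰)`)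
  reduce to those of the frozen one, with no bound on `Λ̇ᵢ` (the stabiliser twist) needed.
-/

set_option linter.dupNamespace false
-- instance search on the nested operator spaces needs a deeper pending depth (as in `CoordCurvature.lean`)
set_option maxSynthPendingDepth 3

noncomputable section

open scoped ContDiff Topology
open Filter Set Function Literature.Geometry.Lorentzian

namespace Summit.FinalStateConjecture.FinalStateConjecture.Theorems

namespace KSDecay

/-! ### Sharp decay of all derivatives of the Kerr–Schild perturbation -/

-- the algebraic and the operator-norm instance paths on `E4 →L[ℝ] E4 →L[ℝ] ℝ` unify slowly
set_option synthInstance.maxHeartbeats 200000 in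
/-- **Sharp decay of all derivatives of the Kerr–Schild perturbation**: for every order `m` there are
`C ≥ 0` and `R₀ > 0` with `‖Dᵐ (g_{M,a} − η)(x)‖ ≤ C / ‖x~‖^{m+1}` whenever `r(x) ≥ R₀`. Scaling proof
of `Kerr.norm_iteratedFDeriv_ksPert_le` with the factor `ε^{m+1}`, `ε = 1/‖x~‖`, kept.
Kerr–Schild 1965, §2–§3 (homogeneity and asymptotic flatness of the Kerr–Schild form).
[cite: KerrSchild1965, §3] -/
theorem norm_iteratedFDeriv_ksPert_le_sharp (M a : ℝ) (m : ℕ) :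
    ∃ C R₀ : ℝ, 0 ≤ C ∧ 0 < R₀ ∧ ∀ x : E4, R₀ ≤ Kerr.radius a x →
      ‖iteratedFDeriv ℝ m (fun y ↦ Kerr.bilin M a y - Minkowski.bilin) x‖ ≤
        C / E4.spatialNorm x ^ (m + 1) := by
  obtain ⟨B, hB⟩ := Kerr.exists_bound_iteratedFDeriv_ksPert_one m
  refine ⟨|M| * max B 0, max 1 (2 * |a|), by positivity, lt_max_of_lt_left one_pos, fun x hx ↦ ?_⟩
  set s := E4.spatialNorm x with hs
  have hr1 : 1 ≤ Kerr.radius a x := (le_max_left _ _).trans hx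
  have hr0 : 0 < Kerr.radius a x := one_pos.trans_le hr1
  have hrs : Kerr.radius a x ≤ s := Kerr.radius_le_spatialNorm a x
  have hs1 : 1 ≤ s := hr1.trans hrs
  have hs0 : 0 < s := one_pos.trans_le hs1
  have hsa : 2 * |a| ≤ s := (le_max_right _ _).trans (hx.trans hrs)
  set ε := s⁻¹ with hε
  have hε0 : 0 < ε := inv_pos.mpr hs0
  -- zero the time coordinate
  set x' : E4 := x - x 0 • E4.basisVector 0 with hx'
  have hsp : E4.spatial x = E4.spatial x' := by
    have h0 : E4.spatial (E4.basisVector 0) = 0 := by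
      ext i
      simp [E4.spatial_apply]
    rw [hx', map_sub, map_smul, h0, smul_zero, sub_zero]
  have hder := Kerr.iteratedFDeriv_ksPert_eq_of_spatial_eq M a m hsp
  have hrx' : Kerr.radius a x' = Kerr.radius a x := (Kerr.radius_eq_of_spatial_eq a hsp).symm
  have hsx' : E4.spatialNorm x' = s := by rw [hs, E4.spatialNorm, E4.spatialNorm, hsp]
  -- the rescaled point on the unit shell
  set y : E4 := ε • x' with hy
  have hy0 : y 0 = 0 := by simp [hy, hx']
  have hy1 : E4.spatialNorm y = 1 := by
    rw [hy, Kerr.spatialNorm_smul, abs_of_pos hε0, hsx', hε, inv_mul_cancel₀ hs0.ne']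
  have ha' : |ε * a| ≤ 1 / 2 := by
    rw [abs_mul, abs_of_pos hε0, hε]
    rw [inv_mul_le_iff₀ hs0]
    linarith
  have hry : 0 < Kerr.radius (ε * a) y := by
    rw [hy, Kerr.radius_smul hε0, hrx']
    exact mul_pos hε0 hr0
  -- scaling of the iterated derivative
  have hfun : (fun y ↦ Kerr.bilin M a y - Minkowski.bilin) =
      fun z ↦ (ε * M) • (Kerr.bilin 1 (ε * a) (ε • z) - Minkowski.bilin) :=
    funext fun z ↦ Kerr.ksPert_smul hε0 M a z
  have hB0 : 0 ≤ max B 0 := le_max_right _ _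
  have hkey := norm_iteratedFDeriv_const_smul_comp_smul_le
    (fun y ↦ Kerr.bilin 1 (ε * a) y - Minkowski.bilin) (ε * M) hε0.ne' x' (m := m)
    (Kerr.contDiffAt_ksPert (M := 1) hry)
  have hεpow : ε * |ε| ^ m = (s ^ (m + 1))⁻¹ := by
    rw [abs_of_pos hε0, hε, ← inv_pow, pow_succ, mul_comm]
  calc ‖iteratedFDeriv ℝ m (fun y ↦ Kerr.bilin M a y - Minkowski.bilin) x‖
        = ‖iteratedFDeriv ℝ m (fun y ↦ Kerr.bilin M a y - Minkowski.bilin) x'‖ := by rw [hder]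
    _ = ‖iteratedFDeriv ℝ m
          (fun z ↦ (ε * M) • (Kerr.bilin 1 (ε * a) (ε • z) - Minkowski.bilin)) x'‖ := by
        rw [← hfun]
    _ ≤ |ε * M| * |ε| ^ m *
          ‖iteratedFDeriv ℝ m (fun y ↦ Kerr.bilin 1 (ε * a) y - Minkowski.bilin) y‖ := hkey
    _ ≤ |ε * M| * |ε| ^ m * max B 0 := by
        gcongr
        exact (hB _ ha' y hy0 hy1).trans (le_max_left _ _)
    _ = (ε * |ε| ^ m) * (|M| * max B 0) := by
        rw [abs_mul, abs_of_pos hε0]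
        ring
    _ = |M| * max B 0 / s ^ (m + 1) := by
        rw [hεpow, div_eq_inv_mul]

-- the algebraic and the operator-norm instance paths on `E4 →L[ℝ] E4 →L[ℝ] ℝ` unify slowly
set_option synthInstance.maxHeartbeats 200000 in
/-- **Sharp decay of the first derivative of the Kerr–Schild form**: `‖D g_{M,a}(x)‖ ≤ C / ‖x~‖²`
for `r(x) ≥ R₀` (the case `m = 1` of `norm_iteratedFDeriv_ksPert_le_sharp`; the constant `η` drops
out of the derivative). Kerr–Schild 1965, §3. [cite: KerrSchild1965, §3] -/
theorem norm_fderiv_kerr_bilin_le (M a : ℝ) :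
    ∃ C R₀ : ℝ, 0 ≤ C ∧ 0 < R₀ ∧ ∀ x : E4, R₀ ≤ Kerr.radius a x →
      DifferentiableAt ℝ (fun y ↦ Kerr.bilin M a y) x ∧
        ‖fderiv ℝ (fun y ↦ Kerr.bilin M a y) x‖ ≤ C / E4.spatialNorm x ^ 2 := by
  obtain ⟨C, R₀, hC, hR₀, h⟩ := norm_iteratedFDeriv_ksPert_le_sharp M a 1
  refine ⟨C, R₀, hC, hR₀, fun x hx ↦ ?_⟩
  have hr0 : 0 < Kerr.radius a x := hR₀.trans_le hx
  have hd : DifferentiableAt ℝ (fun y ↦ Kerr.bilin M a y) x :=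
    (Kerr.contDiffAt_bilin M a hr0 (n := 1)).differentiableAt one_ne_zero
  refine ⟨hd, ?_⟩
  have h1 := h x hx
  rw [norm_iteratedFDeriv_one] at h1
  have h2 : fderiv ℝ (fun y ↦ Kerr.bilin M a y - Minkowski.bilin) x =
      fderiv ℝ (fun y ↦ Kerr.bilin M a y) x := fderiv_sub_const _
  rwa [h2] at h1

/-! ### The frozen boosted, translated field -/

/-- The boosted, translated Kerr–Schild field as "frame-compose after evaluating at the rest point":
`boostedKerrBilin Λ p M a y = Ψ_A (g_{M,a}(Λ⁻¹(y − p)))` with `A = Λ⁻¹` and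
`Ψ_A T = (precomp A) ∘ (T ∘ A)`, i.e. `(v, w) ↦ T(Av, Aw)` (Kerr–Schild 1965, Lorentz covariance
of the ansatz). [cite: KerrSchild1965] -/
theorem boostedKerrBilin_eq_frame (Λ : lorentzGroup) (p : E4) (M a : ℝ) (y : E4) :
    boostedKerrBilin Λ p M a y =
      (ContinuousLinearMap.compL ℝ E4 (E4 →L[ℝ] ℝ) (E4 →L[ℝ] ℝ)
          (ContinuousLinearMap.precomp ℝ (((Λ : E4 ≃L[ℝ] E4).symm : E4 →L[ℝ] E4))))
        ((((ContinuousLinearMap.compL ℝ E4 E4 (E4 →L[ℝ] ℝ)).flip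
            (((Λ : E4 ≃L[ℝ] E4).symm : E4 →L[ℝ] E4))) (Kerr.bilin M a (poincareInv Λ p y)))) := by
  refine ContinuousLinearMap.ext fun v ↦ ContinuousLinearMap.ext fun w ↦ ?_
  rw [boostedKerrBilin_apply]
  simp only [ContinuousLinearMap.compL_apply, ContinuousLinearMap.flip_apply,
    ContinuousLinearMap.coe_comp, Function.comp_apply, ContinuousLinearMap.precomp_apply]
  rfl

/-- The inverse Poincaré map `y ↦ Λ⁻¹(y − p)` has derivative `Λ⁻¹` everywhere. [folklore] -/
theorem hasFDerivAt_poincareInv (Λ : lorentzGroup) (p y : E4) :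
    HasFDerivAt (poincareInv Λ p) (((Λ : E4 ≃L[ℝ] E4).symm : E4 →L[ℝ] E4)) y := by
  have h : HasFDerivAt (fun y : E4 ↦ y - p) (ContinuousLinearMap.id ℝ E4) y :=
    (hasFDerivAt_id y).sub_const p
  have h2 := (((Λ : E4 ≃L[ℝ] E4).symm : E4 →L[ℝ] E4)).hasFDerivAt.comp y h
  rw [ContinuousLinearMap.comp_id] at h2
  exact h2

-- the algebraic and the operator-norm instance paths on `E4 →L[ℝ] E4 →L[ℝ] ℝ` unify slowly
set_option synthInstance.maxHeartbeats 400000 in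
set_option maxHeartbeats 800000 in
/-- **Derivative of a frame-composed field** `x ↦ Ψ_A(K(P x))`, `Ψ_A T = (v, w) ↦ T(Av, Aw)`, along a map
`P` with `DP(y) = A`: it is differentiable at `y` with `‖D(Ψ_A ∘ K ∘ P)(y)‖ ≤ ‖A‖³ ‖DK(P y)‖`
(chain rule; `‖Ψ_A T‖ ≤ ‖A‖²‖T‖`). [folklore] -/
theorem norm_fderiv_frameComp_le (K : E4 → E4 →L[ℝ] E4 →L[ℝ] ℝ) (A : E4 →L[ℝ] E4) (P : E4 → E4)
    {y : E4} (hP : HasFDerivAt P A y) (hK : DifferentiableAt ℝ K (P y)) :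
    DifferentiableAt ℝ (fun x ↦ (ContinuousLinearMap.compL ℝ E4 (E4 →L[ℝ] ℝ) (E4 →L[ℝ] ℝ)
        (ContinuousLinearMap.precomp ℝ A))
          ((((ContinuousLinearMap.compL ℝ E4 E4 (E4 →L[ℝ] ℝ)).flip A)) (K (P x)))) y ∧
      ‖fderiv ℝ (fun x ↦ (ContinuousLinearMap.compL ℝ E4 (E4 →L[ℝ] ℝ) (E4 →L[ℝ] ℝ)
        (ContinuousLinearMap.precomp ℝ A))
          ((((ContinuousLinearMap.compL ℝ E4 E4 (E4 →L[ℝ] ℝ)).flip A)) (K (P x)))) y‖ ≤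
        ‖A‖ ^ 3 * ‖fderiv ℝ K (P y)‖ := by
  -- the frame-composition operator `Ψ T = (precomp A) ∘ (T ∘ A)` and its norm
  set Ψ : (E4 →L[ℝ] E4 →L[ℝ] ℝ) →L[ℝ] (E4 →L[ℝ] E4 →L[ℝ] ℝ) :=
    (ContinuousLinearMap.compL ℝ E4 (E4 →L[ℝ] ℝ) (E4 →L[ℝ] ℝ) (ContinuousLinearMap.precomp ℝ A)).comp
      ((ContinuousLinearMap.compL ℝ E4 E4 (E4 →L[ℝ] ℝ)).flip A) with hΨ
  have hΨapply : ∀ (T : E4 →L[ℝ] E4 →L[ℝ] ℝ) (v w : E4), Ψ T v w = T (A v) (A w) := by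
    intro T v w
    simp [hΨ]
  have hΨnorm : ∀ T : E4 →L[ℝ] E4 →L[ℝ] ℝ, ‖Ψ T‖ ≤ ‖A‖ ^ 2 * ‖T‖ := by
    intro T
    refine ContinuousLinearMap.opNorm_le_bound₂ _ (by positivity) fun v w ↦ ?_
    rw [hΨapply]
    calc ‖T (A v) (A w)‖ ≤ ‖T‖ * ‖A v‖ * ‖A w‖ := T.le_opNorm₂ (A v) (A w)
      _ ≤ ‖T‖ * (‖A‖ * ‖v‖) * (‖A‖ * ‖w‖) := by
          gcongr
          · exact A.le_opNorm v
          · exact A.le_opNorm w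
      _ = ‖A‖ ^ 2 * ‖T‖ * ‖v‖ * ‖w‖ := by ring
  have hfun : (fun x ↦ (ContinuousLinearMap.compL ℝ E4 (E4 →L[ℝ] ℝ) (E4 →L[ℝ] ℝ)
      (ContinuousLinearMap.precomp ℝ A))
        ((((ContinuousLinearMap.compL ℝ E4 E4 (E4 →L[ℝ] ℝ)).flip A)) (K (P x)))) =
      fun x ↦ Ψ (K (P x)) := rfl
  have hKP : HasFDerivAt (K ∘ P) ((fderiv ℝ K (P y)).comp A) y := hK.hasFDerivAt.comp y hP
  have hall : HasFDerivAt (fun x ↦ Ψ (K (P x))) (Ψ.comp ((fderiv ℝ K (P y)).comp A)) y :=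
    Ψ.hasFDerivAt.comp y hKP
  rw [hfun]
  refine ⟨hall.differentiableAt, ?_⟩
  rw [hall.fderiv]
  refine ContinuousLinearMap.opNorm_le_bound _ (by positivity) fun w ↦ ?_
  rw [ContinuousLinearMap.comp_apply, ContinuousLinearMap.comp_apply]
  calc ‖Ψ ((fderiv ℝ K (P y)) (A w))‖
      ≤ ‖A‖ ^ 2 * ‖(fderiv ℝ K (P y)) (A w)‖ := hΨnorm _
    _ ≤ ‖A‖ ^ 2 * (‖fderiv ℝ K (P y)‖ * (‖A‖ * ‖w‖)) := by
        gcongr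
        exact ((fderiv ℝ K (P y)).le_opNorm (A w)).trans
          (mul_le_mul_of_nonneg_left (A.le_opNorm w) (norm_nonneg _))
    _ = ‖A‖ ^ 3 * ‖fderiv ℝ K (P y)‖ * ‖w‖ := by ring

-- the algebraic and the operator-norm instance paths on `E4 →L[ℝ] E4 →L[ℝ] ℝ` unify slowly
set_option synthInstance.maxHeartbeats 400000 in
set_option maxHeartbeats 800000 in
/-- **Sharp spatial decay of the first derivative of the FROZEN boosted Kerr–Schild field.** There are
`C ≥ 0`, `R₀ > 0` (depending on `M, a` only) such that for every Lorentz transformation `Λ`, centre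
event `p` and point `y` with `r(Λ⁻¹(y − p)) ≥ R₀`, the field `boostedKerrBilin Λ p M a` is
differentiable at `y` and `‖D(boostedKerrBilin Λ p M a)(y)‖ ≤ C ‖Λ⁻¹‖³ / ‖(Λ⁻¹(y − p))~‖²`
(chain rule through `y ↦ Λ⁻¹(y − p)` and the frame composition, `norm_fderiv_frameComp_le`, with
`norm_fderiv_kerr_bilin_le`). Kerr–Schild 1965, §3 with the Lorentz covariance of the ansatz.
[cite: KerrSchild1965, §3] -/
theorem norm_fderiv_boostedKerrBilin_le (M a : ℝ) :
    ∃ C R₀ : ℝ, 0 ≤ C ∧ 0 < R₀ ∧ ∀ (Λ : lorentzGroup) (p y : E4),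
      R₀ ≤ Kerr.radius a (poincareInv Λ p y) →
        DifferentiableAt ℝ (boostedKerrBilin Λ p M a) y ∧
          ‖fderiv ℝ (boostedKerrBilin Λ p M a) y‖ ≤
            C * ‖(((Λ : E4 ≃L[ℝ] E4).symm : E4 →L[ℝ] E4))‖ ^ 3 /
              E4.spatialNorm (poincareInv Λ p y) ^ 2 := by
  obtain ⟨C, R₀, hC, hR₀, h⟩ := norm_fderiv_kerr_bilin_le M a
  refine ⟨C, R₀, hC, hR₀, fun Λ p y hy ↦ ?_⟩
  obtain ⟨hKd, hKb⟩ := h (poincareInv Λ p y) hy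
  have hfun : boostedKerrBilin Λ p M a = fun x ↦
      (ContinuousLinearMap.compL ℝ E4 (E4 →L[ℝ] ℝ) (E4 →L[ℝ] ℝ)
          (ContinuousLinearMap.precomp ℝ (((Λ : E4 ≃L[ℝ] E4).symm : E4 →L[ℝ] E4))))
        ((((ContinuousLinearMap.compL ℝ E4 E4 (E4 →L[ℝ] ℝ)).flip
            (((Λ : E4 ≃L[ℝ] E4).symm : E4 →L[ℝ] E4)))
          ((fun z ↦ Kerr.bilin M a z) (poincareInv Λ p x)))) :=
    funext fun x ↦ boostedKerrBilin_eq_frame Λ p M a x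
  obtain ⟨hd, hb⟩ := norm_fderiv_frameComp_le (fun z ↦ Kerr.bilin M a z)
    (((Λ : E4 ≃L[ℝ] E4).symm : E4 →L[ℝ] E4)) (poincareInv Λ p) (hasFDerivAt_poincareInv Λ p y) hKd
  rw [hfun]
  refine ⟨hd, hb.trans ?_⟩
  have hs : 0 ≤ E4.spatialNorm (poincareInv Λ p y) ^ 2 := sq_nonneg _
  calc ‖(((Λ : E4 ≃L[ℝ] E4).symm : E4 →L[ℝ] E4))‖ ^ 3 *
        ‖fderiv ℝ (fun z ↦ Kerr.bilin M a z) (poincareInv Λ p y)‖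
      ≤ ‖(((Λ : E4 ≃L[ℝ] E4).symm : E4 →L[ℝ] E4))‖ ^ 3 * (C / E4.spatialNorm (poincareInv Λ p y) ^ 2) :=
        mul_le_mul_of_nonneg_left hKb (by positivity)
    _ = C * ‖(((Λ : E4 ≃L[ℝ] E4).symm : E4 →L[ℝ] E4))‖ ^ 3 /
          E4.spatialNorm (poincareInv Λ p y) ^ 2 := by ring

/-! ### Spatial derivatives see only the frozen field -/

/-- **Spatial derivatives of functions agreeing on a time slice.** If `f` and `g` are differentiable at
`y` and agree on the slice `{z | z⁰ = y⁰}`, then `Df(y) w = Dg(y) w` for every spatial direction `w`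
(`w⁰ = 0`): both are the derivative at `0` of `s ↦ f(y + s w) = g(y + s w)`. [folklore] -/
theorem fderiv_apply_eq_of_eqOn_slice {F : Type*} [NormedAddCommGroup F] [NormedSpace ℝ F]
    {f g : E4 → F} {y : E4} (hf : DifferentiableAt ℝ f y) (hg : DifferentiableAt ℝ g y)
    (h : ∀ z : E4, z 0 = y 0 → f z = g z) {w : E4} (hw : w 0 = 0) :
    fderiv ℝ f y w = fderiv ℝ g y w := by
  -- the line `s ↦ y + s • w` stays in the slice
  have hline : ∀ s : ℝ, (y + s • w) 0 = y 0 := fun s ↦ by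
    simp [hw]
  have hγ : HasDerivAt (fun s : ℝ ↦ y + s • w) w 0 := by
    have h1 : HasDerivAt (fun s : ℝ ↦ s • w) ((1 : ℝ) • w) 0 := (hasDerivAt_id (0 : ℝ)).smul_const w
    rw [one_smul] at h1
    exact h1.const_add y
  have hf' : HasDerivAt (fun s : ℝ ↦ f (y + s • w)) (fderiv ℝ f y w) 0 :=
    hf.hasFDerivAt.comp_hasDerivAt_of_eq 0 hγ (by simp)
  have hg' : HasDerivAt (fun s : ℝ ↦ g (y + s • w)) (fderiv ℝ g y w) 0 :=
    hg.hasFDerivAt.comp_hasDerivAt_of_eq 0 hγ (by simp)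
  have heq : (fun s : ℝ ↦ f (y + s • w)) = fun s ↦ g (y + s • w) :=
    funext fun s ↦ h _ (hline s)
  rw [heq] at hf'
  exact hf'.unique hg'

end KSDecay

-- the algebraic and the operator-norm instance paths on `E4 →L[ℝ] E4 →L[ℝ] ℝ` unify slowly
set_option synthInstance.maxHeartbeats 400000 in
/-- Registered sub-goal form (stub `norm_fderiv_boostedKerrBilin_le_sharp` of the crux item) of
`KSDecay.norm_fderiv_boostedKerrBilin_le`: sharp `O(1/‖z~‖²)` decay of the first derivative of the frozen
boosted, translated Kerr–Schild field. [cite: KerrSchild1965, §3] -/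
theorem norm_fderiv_boostedKerrBilin_le_sharp : open Literature.Geometry.Lorentzian in ∀ (M a : ℝ), ∃ C R₀ : ℝ, 0 ≤ C ∧ 0 < R₀ ∧ ∀ (Λ : lorentzGroup) (p y : E4), R₀ ≤ Kerr.radius a (poincareInv Λ p y) → DifferentiableAt ℝ (boostedKerrBilin Λ p M a) y ∧ ‖fderiv ℝ (boostedKerrBilin Λ p M a) y‖ ≤ C * ‖(((Λ : E4 ≃L[ℝ] E4).symm : E4 →L[ℝ] E4))‖ ^ 3 / E4.spatialNorm (poincareInv Λ p y) ^ 2 :=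
  KSDecay.norm_fderiv_boostedKerrBilin_le

end Summit.FinalStateConjecture.FinalStateConjecture.Theorems

end
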